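import Literature.Geometry.Lorentzian.Sweep2

/-! Scratch checks for drefute stmt-FinalStateConjecture-10606 / line polynomial-closure. -/

noncomputable section

open Literature.Geometry.Lorentzian
open scoped Manifold ContDiff Topology ENNReal
open Set Filter

namespace DrefuteScratch

/-- ANCHOR for the stub-3 note: an admissible Teukolsky field (the class over which
`TeukolskyLawAt` / stub 1 / the hypothesis of stub 3 quantify) has Cauchy data of its smooth
tensor representative `T` vanishing identically on a COLLAR `{t* = 0, r₊ < r < r₊ + ε}` of the
future event horizon, `ε = ε(α) > 0`: the class never sees data with non-zero trace on `H⁺`. -/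
theorem collar_of_admissible [Kerr.Facts] {M a : ℝ}
    [(Kerr.metric M a (Kerr.rPlus M a)).HasLeviCivita] {s : ℤ} {α : Kerr.exterior M a → ℂ}
    (h : Kerr.IsAdmissibleTeukolskyField M a s α) :
    ∃ T : Kerr.exterior M a → Fin 4 → Fin 4 → ℂ,
      (∀ x : Kerr.exterior M a, x.1 ∉ Kerr.axis → T x = Kerr.tensorise a s α x) ∧
      ∃ ε : ℝ, 0 < ε ∧ ∀ x : Kerr.exterior M a, (x : E4) 0 = 0 →
        Kerr.radius a x < Kerr.rPlus M a + ε →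
          T x = 0 ∧ mfderiv 𝓘(ℝ, E4) 𝓘(ℝ, Fin 4 → Fin 4 → ℂ) T x = 0 := by
  obtain ⟨⟨T, -, hT, K, hK, hdata⟩, -⟩ := h
  refine ⟨T, hT, ?_⟩
  by_cases hne : K.Nonempty
  · -- the radius attains its minimum on the compact `K`, and that minimum exceeds `r₊`
    have hcont : ContinuousOn (fun x : Kerr.exterior M a ↦ Kerr.radius a x.1) K :=
      ((Kerr.continuous_radius a).comp continuous_subtype_val).continuousOn
    obtain ⟨x₀, hx₀K, hmin⟩ := hK.exists_isMinOn hne hcont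
    have hx₀ : Kerr.rPlus M a < Kerr.radius a x₀.1 :=
      (le_max_left _ _).trans_lt (Kerr.mem_exterior.1 x₀.2)
    refine ⟨Kerr.radius a x₀.1 - Kerr.rPlus M a, sub_pos.2 hx₀, fun x hx0 hxr ↦ hdata x hx0 ?_⟩
    intro hxK
    have := hmin hxK
    simp only [mem_setOf_eq] at this
    linarith
  · refine ⟨1, one_pos, fun x hx0 _ ↦ hdata x hx0 ?_⟩
    intro hxK
    exact hne ⟨x, hxK⟩

/-- Stub 2's box `{|a| ≤ M, x⁰ = 0, M ≤ r_a(x) ≤ R}` is NON-EMPTY for `0 < M ≤ R`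
(witness `a = 0`, `x = (0, M, 0, 0)`: Schwarzschild, `r = ‖x⃗‖ = M`). -/
example {M R : ℝ} (hM : 0 < M) (hR : M ≤ R) :
    ∃ (a : ℝ) (x : E4), |a| ≤ M ∧ x 0 = 0 ∧ M ≤ Kerr.radius a x ∧ Kerr.radius a x ≤ R := by
  refine ⟨0, E4.ofTimeSpace 0 (EuclideanSpace.single 0 M), by simp [hM.le], by simp, ?_, ?_⟩
  · rw [Kerr.radius_zero_left, E4.spatialNorm_ofTimeSpace, PiLp.norm_single, Real.norm_eq_abs, abs_of_pos hM]
  · rw [Kerr.radius_zero_left, E4.spatialNorm_ofTimeSpace, PiLp.norm_single, Real.norm_eq_abs, abs_of_pos hM]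
    exact hR

/-- Stationarity: the Kerr–Schild radius does not see `t*` … -/
theorem radius_ofTimeSpace (a t : ℝ) (y : E3) :
    Kerr.radius a (E4.ofTimeSpace t y) = Kerr.radius a (E4.ofTimeSpace 0 y) := by
  have h3 : ∀ t' : ℝ, E4.ofTimeSpace t' y 3 = y 2 := fun t' ↦ rfl
  simp only [Kerr.radius, E4.spatialNorm_ofTimeSpace, h3]

/-- … hence neither does `H` … -/
theorem scalarH_ofTimeSpace (M a t : ℝ) (y : E3) :
    Kerr.scalarH M a (E4.ofTimeSpace t y) = Kerr.scalarH M a (E4.ofTimeSpace 0 y) := by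
  have h3 : ∀ t' : ℝ, E4.ofTimeSpace t' y 3 = y 2 := fun t' ↦ rfl
  simp only [Kerr.scalarH, radius_ofTimeSpace a t y, h3]

/-- … nor `ℓ_μ` (so the hypothesis `x 0 = 0` of stub 2 is immaterial: leg (β) holds at every `t*`). -/
theorem nullCovectorFun_ofTimeSpace (a t : ℝ) (y : E3) (μ : Fin 4) :
    Kerr.nullCovectorFun a (E4.ofTimeSpace t y) μ = Kerr.nullCovectorFun a (E4.ofTimeSpace 0 y) μ := by
  have h1 : ∀ t' : ℝ, E4.ofTimeSpace t' y 1 = y 0 := fun t' ↦ rfl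
  have h2 : ∀ t' : ℝ, E4.ofTimeSpace t' y 2 = y 1 := fun t' ↦ rfl
  have h3 : ∀ t' : ℝ, E4.ofTimeSpace t' y 3 = y 2 := fun t' ↦ rfl
  simp only [Kerr.nullCovectorFun, radius_ofTimeSpace a t y, h1, h2, h3]

/-- The local-energy region of the law is EMPTY below the horizon scale: if `‖y‖ ≤ R` and
`(τ, y) ∈ Kerr.exterior M a` then `R ≥ r > r₊` is needed; precisely `r_a(τ,y) ≤ ‖y‖`
(`ρ² = r² + a² sin²θ ≥ r²`). Recorded: `Kerr.radius a x ≤ E4.spatialNorm x`. -/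
theorem radius_le_spatialNorm (a : ℝ) (x : E4) : Kerr.radius a x ≤ E4.spatialNorm x := by
  have hq := Kerr.radius_quartic a x
  have hr := Kerr.radius_nonneg a x
  have hρ := E4.spatialNorm_nonneg x
  by_contra hlt
  push Not at hlt
  have h1 : E4.spatialNorm x ^ 2 < Kerr.radius a x ^ 2 := by nlinarith
  -- z² ≤ ρ²
  have hz : x 3 ^ 2 ≤ E4.spatialNorm x ^ 2 := by
    have h3 : x 3 = E4.spatial x 2 := rfl
    have hn : E4.spatialNorm x ^ 2 = ∑ i, ‖E4.spatial x i‖ ^ 2 := by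
      rw [E4.spatialNorm, EuclideanSpace.norm_eq,
        Real.sq_sqrt (Finset.sum_nonneg fun i _ ↦ by positivity)]
    rw [hn, Fin.sum_univ_three, h3]
    have e : ‖E4.spatial x 2‖ ^ 2 = (E4.spatial x 2) ^ 2 := by rw [Real.norm_eq_abs, sq_abs]
    nlinarith [sq_nonneg ‖E4.spatial x 0‖, sq_nonneg ‖E4.spatial x 1‖]
  have hA : 0 < Kerr.radius a x ^ 2 * (Kerr.radius a x ^ 2 - E4.spatialNorm x ^ 2) :=
    mul_pos (by nlinarith) (by nlinarith)
  have hB : 0 ≤ a ^ 2 * (Kerr.radius a x ^ 2 - x 3 ^ 2) := mul_nonneg (sq_nonneg a) (by nlinarith)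
  have key : Kerr.radius a x ^ 2 * (Kerr.radius a x ^ 2 - E4.spatialNorm x ^ 2) +
      a ^ 2 * (Kerr.radius a x ^ 2 - x 3 ^ 2) = 0 := by
    linear_combination hq
  linarith

end DrefuteScratch

end
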